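import Summits.ABC.ABC.Theses.IUTThetaPilot
import Summits.ABC.ABC.Theorems.IUTThetaPilotThetaPartIIDegLe
import Summits.ABC.ABC.Theorems.IUTThetaPilotABCExpThreeDegOnePrelims
import Literature.IUT.LogVolume.Corollary22PartIIICore
import Literature.IUT.LogVolume.Corollary22PartIIPointwise
import HarnessLib

/-!
# Route `IUTThetaPilot`, crux `ThetaPartII` (stmt-ABC-19678): the «d = 1 cut» WITHOUT `K_V` —
# [IUTchIII] Cor. 3.12 at the Θ-data of the RATIONAL points of the `λ`-line ⟹ `c ≤ C·rad(abc)^{3+ε}` for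
# EVERY abc triple (a POLYNOMIAL abc bound), reading (U), no Step-(v) symmetrisation, no `GenEllTwo`

Mochizuki, *Inter-universal Teichmüller theory IV*, RIMS manuscript (Apr. 2020; = PRIMS **57** (2021)), Cor. 2.2
(ii), statement pp. 41–43, proof pp. 43–48 [cite: Mochizuki2012, IUTchIV Cor. 2.2 (ii) pp. 41–48]; Thm. 1.10
pp. 22–31 (rests on [IUTchIII] Cor. 3.12 — DISPUTED; enters below only through the named interface
`Cor22.Thm110LegendreUpTo 1`, fed by the registered stub `stub_cor312` RESTRICTED TO DEGREE-1 POINTS).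

PROOF-ONLY helper on the crux item (does not close it). TAKES NO SIDE on [IUTchIII] Cor. 3.12.

WHAT IS NEW. The cell's «d = 1 cut» (`ThetaPartIIDisplay.vojtaIneq_two_degOne_of_cor312`, abc-iut-S2/c312-8)
gives Vojta/abc with the printed `(1+ε)` for the rational points of every COMPACTLY BOUNDED `K_V ∋ 2` — i.e.
for BALANCED, `2`-tame triples only. Reading the proof of Cor. 2.2 (ii) (pp. 43–48) shows that `K_V` enters
ONLY through assertion (i)'s bounded discrepancies: the `2`-part `B_K` of `log(q^∀)` (p. 47) and the
archimedean part behind the `Exc_d`-finiteness steps and (P4)'s `T_K` (p. 45); the choice of `l`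
((S1)–(S3), (P1)–(P3) pp. 44–45), (P5), (P7) and the application of Thm. 1.10 are `K_V`-free. At the
Frey–Legendre point `λ = a/c ∈ ℚ` of an ARBITRARY abc triple these discrepancies are explicit
(`Corollary22FreyPoint.lean`: `ht_∞ ≤ 6·log c + log 256`, `2·log (abc)_{odd} ≤ log(q^{∤2})`, `c ≤ 2·(abc)_{odd}`;
(P4) by `GenEll.exists_degInf_le_of_admitsLCyclic_of_htInf_le_three` + `Cor22.logQForall_le_degInf_thetaEllPoint`),
so the argument of pp. 43–48 runs WITHOUT `K_V`, the `2`-part being simply dropped from the left side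
(`𝕍^bad_mod` has odd residue characteristic, [IUTchI] Def. 3.1): for every `ε > 0`,
`log c ≤ 3(1+ε)·log rad(abc) + C_ε`, i.e. **`c ≤ C_ε·rad(abc)^{3+ε}` for EVERY abc triple**
(`abc_exp_three_of_thm110LegendreUpTo_one`). Composed with the tree's (U)-line at degree one
(`thm110LegendreUpTo_of_squeezeIII`, `hullVolumeAtDatum_BIII_of_degree_le_one` — RISK ¶7's slot residue is
void at `d_mod = 1`): `abc_exp_three_of_cor312_degOne` — [IUTchIII] Cor. 3.12 in reading (U) at the genuine
Θ-data of the rational points of the `λ`-line ALONE yields a polynomial abc bound (exponent `3 + ε`); the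
Step-(v) symmetrisation / per-image reading is what the passage from `3+ε` to `1+ε` (via `K_V`-Vojta in all
degrees and [GenEll] Thm. 2.1) needs. CONDITIONAL (`proof.conditional`); nothing asserted; no side taken.
-/

set_option linter.dupNamespace false

noncomputable section

namespace Summit.ABC.ABC.Theorems.ThetaPartIIDegOne

open Literature.IUT.LogVolume Literature.IUT.LogVolume.Cor22
open Literature.NumberTheory.DiophantineGeometry Literature.NumberTheory.DiophantineGeometry.GenEll
open NumberField IsDedekindDomain Real

/-! ## The main theorem: `Thm110LegendreUpTo 1 ⟹ log c ≤ 3(1+ε)·log rad(abc) + C_ε` for EVERY abc triple -/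

/-- **[IUTchIV] Thm. 1.10 at the RATIONAL points of the `λ`-line (`Cor22.Thm110LegendreUpTo 1`) implies
`log c ≤ 3·(1+ε)·log rad(abc) + C_ε` for every `0 < ε ≤ 1` and EVERY abc triple** — Cor. 2.2 (ii)'s proof
(pp. 43–48) run at `λ = a/c` without `K_V`: `Exc`-steps become «`log(q^∀) ≤ H` ⟹ `log c ≤ H/2 + log 2`»
(`2·log (abc)_{odd} ≤ log(q^{∤2}) ≤ log(q^∀)`, `c ≤ 2(abc)_{odd}`); the prime `l` of (P1)–(P3)
(`Cor22.exists_prime_P1_P2_P3_point`); (P5) by the `K_V`-free exclusion `sq_le_of_le_add_mul_log`; (P6) by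
`condP6_ratPoint_triple`; the display of Thm. 1.10 with `d_mod = 1`, `log-diff = 0`, `log(𝔣) ≤ log rad(abc)`;
the error terms `∝ √h·log(2δh)` absorbed by `Cor22.exists_threshold_sixtyDeltaSq_log_div_sqrt_le`; the
`2`-part of `log(q^∀)` is dropped from the LEFT side only. CONDITIONAL on `h110`; no side taken.
[cite: Mochizuki2012, IUTchIV Cor. 2.2 (ii) proof pp. 43–48] [claim: Mochizuki2012, status: disputed] -/
theorem log_le_three_mul_of_thm110LegendreUpTo_one (h110 : Thm110LegendreUpTo 1) {ε : ℝ} (hε : 0 < ε)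
    (hε1 : ε ≤ 1) :
    ∃ C : ℝ, ∀ a b c : ℕ, IsABCTriple a b c →
      Real.log c ≤ 3 * (1 + ε) * Real.log (rad a b c) + C := by
  classical
  obtain ⟨ξ, hξ⟩ := exists_isXiPrm
  have hξ5 : 5 ≤ ξ := hξ.1
  obtain ⟨η, hη⟩ := exists_isEtaPrm
  have hη0 : 0 < η := hη.1
  obtain ⟨G₀, hG₀⟩ := condP6_ratPoint_triple
  obtain ⟨H₃, hH₃0, hH₃⟩ := exists_threshold_sixtyDeltaSq_log_div_sqrt_le
  set ε₁ : ℝ := ε / 6 with hε₁def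
  have hε₁0 : 0 < ε₁ := by positivity
  have hε₁1 : ε₁ ≤ 1 := by rw [hε₁def]; linarith
  obtain ⟨Hthr, hHthr⟩ : ∃ Hthr : ℝ, Hthr = H₃ * ε₁ ^ (-(3 : ℝ)) * (1 : ℝ) ^ (-(3 : ℝ)) * ((1 : ℕ) : ℝ) ^ (4 + (1 : ℝ)) :=
    ⟨_, rfl⟩
  obtain ⟨δ, hδdef⟩ : ∃ δ : ℝ, δ = delta 1 := ⟨_, rfl⟩
  have hδv : δ = 552960 := by rw [hδdef]; unfold delta; norm_num
  have hδ2 : 2 ≤ δ := by rw [hδv]; norm_num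
  have hδ5 : 552960 ≤ δ := by rw [hδv]
  -- the height threshold below which everything is absorbed into the constant
  set H₁ : ℝ := ξ ^ 2 + 50 + max G₀ 0 + max Hthr 0 + (80 / ε) ^ 2 + (91 + 6 * δ) ^ 4 with hH₁
  have hG0 : 0 ≤ max G₀ 0 := le_max_right _ _
  have hT0 : 0 ≤ max Hthr 0 := le_max_right _ _
  have hε80 : 0 ≤ (80 / ε) ^ 2 := sq_nonneg _
  have h43 : 0 ≤ (91 + 6 * δ) ^ 4 := by positivity
  have hξ0 : 0 ≤ ξ ^ 2 := sq_nonneg _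
  have hH₁0 : 0 ≤ H₁ := by rw [hH₁]; positivity
  have hlog2 : Real.log 2 ≤ 1 := by have := Real.log_two_lt_d9; linarith
  have hlog2' : 0 < Real.log 2 := Real.log_pos (by norm_num)
  refine ⟨H₁ / 2 + 1 + 5 * ε₁ + 120 * η, fun a b c ht => ?_⟩
  obtain ⟨P, hP⟩ : ∃ P : NFPoint, P = ratPoint ((a : ℚ) / c) := ⟨_, rfl⟩
  have hmem : P ∈ UPle 1 := by rw [hP]; exact ratPoint_triple_mem ht
  have hPU : P ∈ UP := hmem.1
  have hdeg : P.degree ≤ 1 := hmem.2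
  have hInU : P.InU := hPU.1
  -- the quantities of the triple
  have hcpos : 0 < c := by have := ht.2.2.1; have := ht.1; omega
  have hc0 : (0 : ℝ) < c := by exact_mod_cast hcpos
  obtain ⟨X, hX⟩ : ∃ X : ℝ, X = Real.log (ordCompl[2] (a * b * c) : ℕ) := ⟨_, rfl⟩
  obtain ⟨h, hh⟩ : ∃ h : ℝ, h = logQForall P := ⟨_, rfl⟩
  obtain ⟨R, hR⟩ : ∃ R : ℝ, R = Real.log (rad a b c) := ⟨_, rfl⟩
  have hR0 : 0 ≤ R := by
    have : 0 < rad a b c := by rw [rad_def]; exact Nat.pos_of_ne_zero UniqueFactorizationMonoid.radical_ne_zero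
    rw [hR]; exact Real.log_nonneg (by exact_mod_cast this)
  have hX2 : 2 * X ≤ logQNotTwo P := by rw [hX, hP]; exact two_mul_log_oddPart_le_logQNotTwo ht
  have hq2h : logQNotTwo P ≤ h := by rw [hh]; exact logQAvoid_anti P (Finset.empty_subset _)
  have hhht : h ≤ htInfty P := by rw [hh]; exact logQForall_le_htInfty P
  have hht : htInfty P ≤ 6 * Real.log c + Real.log 256 := by rw [hP]; exact htInfty_ratPoint_triple_le ht
  have hc2 : (c : ℝ) ≤ 2 * (ordCompl[2] (a * b * c) : ℕ) := natCast_le_two_mul_oddPart ht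
  have hodd0 : (0 : ℝ) < (ordCompl[2] (a * b * c) : ℕ) := by linarith
  have hlogc : Real.log c ≤ X + Real.log 2 := by
    rw [hX, add_comm, ← Real.log_mul (by norm_num) hodd0.ne']
    exact Real.log_le_log hc0 hc2
  have hlog256 : Real.log 256 = 8 * Real.log 2 := by
    rw [show (256 : ℝ) = 2 ^ 8 by norm_num, Real.log_pow]; norm_num
  have hh6 : h ≤ 6 * X + 10 := by
    have := Real.log_two_lt_d9
    rw [hlog256] at hht
    linarith
  have hh0 : 0 ≤ h := by rw [hh]; exact logQAvoid_nonneg P ∅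
  -- small heights: everything is in the constant
  by_cases hcase : h ≤ H₁
  · have h1 : Real.log c ≤ H₁ / 2 + 1 := by linarith
    have h2 : 0 ≤ 3 * (1 + ε) * R := by positivity
    rw [← hR]
    linarith
  rw [not_le] at hcase
  -- large heights: the argument of pp. 44–48
  obtain ⟨s, hs⟩ : ∃ s : ℝ, s = Real.sqrt h := ⟨_, rfl⟩
  have hs2 : s ^ 2 = h := by rw [hs]; exact Real.sq_sqrt hh0
  have hs0 : 0 ≤ s := by rw [hs]; exact Real.sqrt_nonneg h
  have hξs : ξ ≤ s := by
    rw [hs]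
    calc ξ = Real.sqrt (ξ ^ 2) := (Real.sqrt_sq (by linarith)).symm
      _ ≤ Real.sqrt h := Real.sqrt_le_sqrt (by linarith)
  have h5s : 5 ≤ s := le_trans hξ5 hξs
  have hspos : 0 < s := by linarith
  have h7s : 7 < s := by
    rw [hs, Real.lt_sqrt (by norm_num)]; linarith
  have h80s : 80 / ε ≤ s := by
    rw [hs]
    calc 80 / ε = Real.sqrt ((80 / ε) ^ 2) := (Real.sqrt_sq (by positivity)).symm
      _ ≤ Real.sqrt h := Real.sqrt_le_sqrt (by linarith)
  -- the curves without core: `log(q^∀) ≤ 12`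
  have hcore : AdmitsCore P := by
    by_contra hno
    have := logQForall_le_of_not_admitsCore hno
    rw [← hh] at this
    linarith
  -- the prime `l` of (P1), (P2), (P3)
  obtain ⟨l, hlp, hP1lo, hP1hi, hP2', hP3⟩ :=
    exists_prime_P1_P2_P3_point P hdeg hξ (by rw [hs, hh] at hξs; exact hξs)
  have hP1lo' : s ≤ l := by rw [hs, hh]; exact hP1lo
  have hP1hi' : (l : ℝ) ≤ 10 * δ * s * Real.log (2 * δ * s ^ 2) := by
    rw [hs2, hδdef, hs, hh]; exact hP1hi
  have hl7 : 7 ≤ l := by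
    have : (7 : ℝ) < l := lt_of_lt_of_le h7s hP1lo'
    exact_mod_cast this.le
  have hl5 : 5 ≤ l := le_trans (by norm_num) hl7
  have hl0 : (0 : ℝ) < l := by exact_mod_cast hlp.pos
  have hlR5 : (5 : ℝ) ≤ l := by exact_mod_cast hl5
  haveI : Fact l.Prime := ⟨hlp⟩
  -- (P3): `log(q^{∤2}) − log(q) ≤ h^{1/2}·log l`
  have hQ1 : logQNotTwo P - logQAvoid P {2, l} ≤ s * Real.log l :=
    logQNotTwo_sub_logQAvoid_le P hlp hs0 (fun v hv hres => by
      have := hP3 v hv hres; rw [hs, hh]; exact this.le)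
  have hl_le : (l : ℝ) ≤ 20 * δ ^ 2 * s ^ 4 := l_le_of_P1 h5s hδ2 hP1hi'
  -- (P5): else `h ≤ (91 + 6δ)⁴ ≤ H₁`
  have hP5 : CondP5 P l := by
    by_contra hno
    have hq0 : logQAvoid P {2, l} = 0 := logQAvoid_pair_eq_zero_of_not_condP5 hno
    have hmain : s ^ 2 ≤ 10 + 3 * s * Real.log l := by rw [hs2]; linarith
    have hb := sq_le_of_le_add_mul_log h5s hδ2 (by norm_num : (0 : ℝ) ≤ 10) hlR5 hl_le hmain
    rw [hs2] at hb
    have e : (10 + 81 + 6 * δ : ℝ) ^ 4 = (91 + 6 * δ) ^ 4 := by norm_num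
    linarith
  -- (P6): the `K_V`-free Galois-image input
  have hP6 : CondP6 P l := by
    rw [hP] at hP2' hP5 ⊢
    refine hG₀ a b c ht l hlp hl7 hP2' hP5 ?_
    have := le_max_left G₀ 0
    rw [← hP, ← hh]
    linarith
  -- (P7) + Theorem 1.10: the HYPOTHESIS, with `d_mod = 1`, `log-diff = 0`
  have hdisp : Display P l η := h110 η hη P hPU hdeg l hlp hl5 hcore hP2' hP5 hP6
  have hLD : P.logDiff = 0 := by rw [hP]; exact logDiff_ratPoint _
  have hLc : logCondAvoid P {2, l} ≤ R := by
    rw [hR, ← logCond_ratPoint_triple ht]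
    have := logCondAvoid_le_logCond P hInU {2, l}
    rw [hP] at this ⊢
    exact this
  have hLc0 : 0 ≤ logCondAvoid P {2, l} := logCondAvoid_nonneg P _
  have hd2 : 1 / 6 * logQAvoid P {2, l} ≤
      (1 + 20 / (l : ℝ)) * logCondAvoid P {2, l} + 20 * (552960 * l + η) := by
    have hd := hdisp
    unfold Display at hd
    have e1 : ((dmod P : ℕ) : ℝ) = 1 := by rw [dmod_eq_one_of_degree_le_one hdeg]; simp
    rw [e1, hLD] at hd
    have e : (1 + 20 * (1 : ℝ) / l) * (0 + logCondAvoid P {2, l}) + 20 * (2 ^ 12 * 3 ^ 3 * 5 * (1 : ℝ) * l + η)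
        = (1 + 20 / (l : ℝ)) * logCondAvoid P {2, l} + 20 * (552960 * l + η) := by ring
    rw [← e]; exact hd
  -- `20/l ≤ ε/4`
  have h20 : 20 / (l : ℝ) ≤ ε / 4 := by
    have h80l : 80 / ε ≤ l := le_trans h80s hP1lo'
    rw [div_le_iff₀ hε] at h80l
    rw [div_le_iff₀ hl0]
    linarith
  -- error terms `∝ s·log(2δh)`
  obtain ⟨Λ, hΛ⟩ : ∃ Λ : ℝ, Λ = Real.log (2 * δ * h) := ⟨_, rfl⟩
  have hH₁50 : 50 ≤ H₁ := by rw [hH₁]; linarith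
  have h2δh : 1 < 2 * δ * h := by rw [hδv]; linarith
  have hΛ0 : 0 ≤ Λ := by rw [hΛ]; exact Real.log_nonneg h2δh.le
  obtain ⟨W, hW⟩ : ∃ W : ℝ, W = s * Λ := ⟨_, rfl⟩
  have hW0 : 0 ≤ W := by rw [hW]; exact mul_nonneg hs0 hΛ0
  -- `l ≤ 10δ·W`
  have hlW : (l : ℝ) ≤ 10 * 552960 * W := by
    calc (l : ℝ) ≤ 10 * δ * s * Real.log (2 * δ * s ^ 2) := hP1hi'
      _ = 10 * 552960 * W := by rw [hW, hΛ, ← hs2, hδv]; ring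
  -- `log l ≤ 3Λ` since `l ≤ 20δ²h² ≤ (2δh)³`
  have hlogl : Real.log l ≤ 3 * Λ := by
    have hle : (l : ℝ) ≤ (2 * δ * h) ^ 3 := by
      have e1 : 20 * δ ^ 2 * s ^ 4 = 20 * δ ^ 2 * h ^ 2 := by rw [← hs2]; ring
      rw [e1] at hl_le
      have hk : 0 ≤ δ ^ 2 * h ^ 2 * (8 * δ * h - 20) :=
        mul_nonneg (by positivity) (by rw [hδv]; linarith)
      have e2 : δ ^ 2 * h ^ 2 * (8 * δ * h - 20) = 8 * (δ ^ 3 * h ^ 3) - 20 * (δ ^ 2 * h ^ 2) := by ring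
      have e3 : (2 * δ * h) ^ 3 = 8 * (δ ^ 3 * h ^ 3) := by ring
      rw [e2] at hk
      rw [e3]
      linarith
    calc Real.log l ≤ Real.log ((2 * δ * h) ^ 3) := Real.log_le_log hl0 hle
      _ = 3 * Λ := by rw [Real.log_pow, hΛ]; norm_num
  have hT2 : s * Real.log l ≤ 3 * W := by
    calc s * Real.log l ≤ s * (3 * Λ) := mul_le_mul_of_nonneg_left hlogl hs0
      _ = 3 * W := by rw [hW]; ring
  -- the `ε_E`-type threshold: `(60δ)²·Λ/√h ≤ ε₁`, i.e. `3600δ²·W ≤ ε₁·h`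
  have hHthrh : Hthr ≤ h := by
    have h1 : Hthr ≤ max Hthr 0 := le_max_left _ _
    have h2 : max Hthr 0 ≤ H₁ := by rw [hH₁]; linarith
    linarith
  have hthr : (60 * delta 1) ^ 2 * Real.log (2 * delta 1 * h) / Real.sqrt h ≤ ε₁ := by
    refine hH₃ H₃ le_rfl 1 le_rfl 1 one_pos le_rfl ε₁ hε₁0 hε₁1 h ?_
    rw [hHthr] at hHthrh; exact hHthrh
  have hWle : 3600 * 552960 ^ 2 * W ≤ ε / 6 * h := by
    rw [← hδdef, ← hs, ← hΛ, div_le_iff₀ hspos] at hthr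
    have hm := mul_le_mul_of_nonneg_left hthr hs0
    calc 3600 * 552960 ^ 2 * W = s * ((60 * δ) ^ 2 * Λ) := by rw [hW, hδv]; ring
      _ ≤ s * (ε₁ * s) := hm
      _ = ε / 6 * h := by rw [← hs2, hε₁def]; ring
  -- the pure arithmetic of pp. 46–48
  have hXle := arith_core hε hε1 hR0 hη0.le hLc hl0 hX2 hQ1 hd2 h20 hlW hT2 hWle hh6
  rw [hε₁def, ← hR]
  linarith

/-- **`c < C_ε·rad(abc)^{3+ε}` for EVERY abc triple from `Cor22.Thm110LegendreUpTo 1`** (exponential form of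
`log_le_three_mul_of_thm110LegendreUpTo_one` with `ε/3`): [IUTchIV] Thm. 1.10 at the rational points of the
`λ`-line (the display p. 46 l. 1 at `d_mod = 1`; it rests on [IUTchIII] Cor. 3.12 — DISPUTED) implies a
POLYNOMIAL abc bound with exponent `3 + ε`, with NO compactly bounded subset and NO [GenEll] Thm. 2.1.
CONDITIONAL; nothing asserted; no side taken. [cite: Mochizuki2012, IUTchIV Cor. 2.2–2.3 pp. 41–55]
[claim: Mochizuki2012, status: disputed] -/
theorem abc_exp_three_of_thm110LegendreUpTo_one (h110 : Thm110LegendreUpTo 1) {ε : ℝ} (hε : 0 < ε) :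
    ∃ C : ℝ, 0 < C ∧ ∀ a b c : ℕ, IsABCTriple a b c →
      (c : ℝ) < C * ((rad a b c : ℕ) : ℝ) ^ (3 + ε) := by
  -- work with `ε' = min(ε,1)/3`
  set ε' : ℝ := min ε 1 / 3 with hε'
  have hε'0 : 0 < ε' := by rw [hε']; positivity
  have hε'1 : ε' ≤ 1 := by
    rw [hε']; have := min_le_right ε 1; linarith
  obtain ⟨C, hC⟩ := log_le_three_mul_of_thm110LegendreUpTo_one h110 hε'0 hε'1
  refine ⟨Real.exp C + 1, by positivity, fun a b c ht => ?_⟩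
  have hlog := hC a b c ht
  have hcpos : 0 < c := by have := ht.2.2.1; have := ht.1; omega
  have hc0 : (0 : ℝ) < c := by exact_mod_cast hcpos
  have hrad : 0 < rad a b c := by rw [rad_def]; exact Nat.pos_of_ne_zero UniqueFactorizationMonoid.radical_ne_zero
  have hr0 : (0 : ℝ) < (rad a b c : ℝ) := by exact_mod_cast hrad
  have hr1 : (1 : ℝ) ≤ (rad a b c : ℝ) := by exact_mod_cast hrad
  have hR0 : 0 ≤ Real.log (rad a b c) := Real.log_nonneg hr1
  -- `3(1+ε')·log rad ≤ (3+ε)·log rad`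
  have h3 : 3 * (1 + ε') * Real.log (rad a b c) ≤ (3 + ε) * Real.log (rad a b c) := by
    apply mul_le_mul_of_nonneg_right _ hR0
    rw [hε']; have := min_le_left ε 1; linarith
  have hle : Real.log c ≤ (3 + ε) * Real.log (rad a b c) + C := by linarith
  have hexp : (c : ℝ) ≤ Real.exp C * (rad a b c : ℝ) ^ (3 + ε) := by
    have h1 : (c : ℝ) = Real.exp (Real.log c) := (Real.exp_log hc0).symm
    have h2 : ((rad a b c : ℕ) : ℝ) ^ (3 + ε) = Real.exp ((3 + ε) * Real.log (rad a b c)) := by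
      rw [Real.rpow_def_of_pos hr0, mul_comm]
    rw [h1, h2, ← Real.exp_add]
    exact Real.exp_le_exp.mpr (by linarith)
  have hpow : 0 < (rad a b c : ℝ) ^ (3 + ε) := Real.rpow_pos_of_pos hr0 _
  calc (c : ℝ) ≤ Real.exp C * (rad a b c : ℝ) ^ (3 + ε) := hexp
    _ < (Real.exp C + 1) * (rad a b c : ℝ) ^ (3 + ε) := by nlinarith

/-! ## Composition with the (U)-line at degree one: [IUTchIII] Cor. 3.12 at the rational points ⟹ polynomial abc -/

/-- **`Cor22.Thm110LegendreUpTo 1` from [IUTchIII] Cor. 3.12 at the genuine Θ-data of the DEGREE-1 points**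
(`stub_cor312` restricted to `P.degree ≤ 1` — the only hypothesis; claim form, DISPUTED): the cell's (U)-line at
degree one — child (i) `stub_thetaData` (THEOREM), the hull-volume estimate (ii′) at `d_mod = 1`
(`hullVolumeAtDatum_BIII_of_degree_le_one`, THEOREM: slot-constant, no Step-(v) symmetrisation residue), the squeeze
`PointDict.logQAvoid_le_of_cor312AtDatum` and print's Step (viii) `thm110LegendreUpTo_of_squeezeIII`.
CONDITIONAL; nothing asserted; no side taken. [cite: Mochizuki2012, IUTchIV Thm. 1.10 proof Steps (ii)–(viii) pp. 24–31]
[claim: Mochizuki2012, status: disputed] -/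
theorem thm110LegendreUpTo_one_of_cor312_degOne
    (h312 : ∀ P : NFPoint, P ∈ UP → P.degree ≤ 1 → ∀ l : ℕ, l.Prime → 5 ≤ l →
      Cor22.AdmitsCore P → Cor22.CondP2 P l → Cor22.CondP5 P l → Cor22.CondP6 P l →
        Cor22.Cor312AtDatum P l) :
    Thm110LegendreUpTo 1 :=
  ThetaPartIIDisplay.thm110LegendreUpTo_of_squeezeIII fun P hP hdeg l hl h5 hcore hP2 hP5 h6 => by
    obtain ⟨T⟩ := Summit.ABC.ABC.Theorems.ThetaPartII.stub_thetaData P hP l hl h5 hcore hP2 hP5 h6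
    exact Summit.ABC.IUTFork.PointDict.logQAvoid_le_of_cor312AtDatum (h312 P hP hdeg l hl h5 hcore hP2 hP5 h6)
      (ThetaPartIIDisplay.hullVolumeAtDatum_BIII_of_degree_le_one hP hdeg hl h5 h6) T hP.1

/-- **THE «d = 1 CUT» WITHOUT `K_V`: [IUTchIII] Cor. 3.12 (reading (U)) at the genuine Θ-data of the RATIONAL
points of the `λ`-line ⟹ `c < C_ε·rad(abc)^{3+ε}` for EVERY abc triple.** The ONLY hypothesis is the registered
stub `stub_cor312` restricted to `P.degree ≤ 1` (claim form, DISPUTED); everything else — child (i), the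
log-volume estimate at `d_mod = 1`, the prime-number-theorem input, the Galois-image input (here in `K_V`-free form),
the Frey–Legendre dictionary — is a THEOREM of the tree. No `GenEllTwo`, no compactly bounded subset, no Step-(v)
symmetrisation (RISK ¶7 is void at `d_mod = 1`). So under the reading of record (U) the disputed Corollary alone
already yields a POLYNOMIAL abc bound; the passage `3+ε ↦ 1+ε` is what needs Cor. 2.2 (ii) in ALL degrees
(hence Step (v) at `d_mod > 1`) and [GenEll] Thm. 2.1. CONDITIONAL (`proof.conditional`); nothing asserted; no
side taken on [IUTchIII] Cor. 3.12. [cite: Mochizuki2012, IUTchIV Cor. 2.2–2.3 pp. 41–55]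
[claim: Mochizuki2012, status: disputed] -/
theorem abc_exp_three_of_cor312_degOne
    (h312 : ∀ P : NFPoint, P ∈ UP → P.degree ≤ 1 → ∀ l : ℕ, l.Prime → 5 ≤ l →
      Cor22.AdmitsCore P → Cor22.CondP2 P l → Cor22.CondP5 P l → Cor22.CondP6 P l →
        Cor22.Cor312AtDatum P l)
    {ε : ℝ} (hε : 0 < ε) :
    ∃ C : ℝ, 0 < C ∧ ∀ a b c : ℕ, IsABCTriple a b c →
      (c : ℝ) < C * ((rad a b c : ℕ) : ℝ) ^ (3 + ε) :=
  abc_exp_three_of_thm110LegendreUpTo_one (thm110LegendreUpTo_one_of_cor312_degOne h312) hε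

end Summit.ABC.ABC.Theorems.ThetaPartIIDegOne

end
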